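import Summits.MatrixMultiplication.OmegaCensus.STPP211Z2pow6DirectChunks

/-!
# (2,1,1)¹⁰ ⊄ (ℤ/2)⁶ — part S2 class 09, decisions 6/7: direct search over the hard class #23 of `reps29` (roots d = 59 (part))

Cell `pub-omega` (unit `pub-omega-stpp-1-g37`), topic `Summits/MatrixMultiplication/OmegaCensus`.
HONEST FRAMING (verbatim): lottery ticket; floor = certified bounds/negative ranges. Census STRUCTURE bookkeeping (B5, `T1((ℤ/2)⁶)`, Pb237);
nothing here is a bound on `ω`.

Class #23 of `reps29` in the translated form `C' = hc09 = [0, 4, 5, 6, 12, 20, 31, 36, 47, 55]` (`+ 4`, block of `c = 4` first; linear stabilizer of order 144,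
root representatives [1, 7, 8, 11, 13, 56, 59, 60, 61]; HOME `pub-omega-stpp-1-g36/code/hard_perd.json`). The kernel evaluates the direct engine
(`STPP211Z2pow6DirectEngine.rootD`, soundness `noNF_of_rootD`) in CHUNKS of the root node (`STPP211Z2pow6DirectChunks.rootDX`, ≤ 10⁵ search
calls each, exact counts from the seat's C mirror `godc.c`; this file: 490,119 calls) and assembles `rootD C' d = true` per root by
`rootD_of_chunks`. The class theorem follows in `STPP211Z2pow6Hard09Class` (symmetry transport, `STPP211Z2pow6DirectTransport`).

References: H. Cohn, R. Kleinberg, B. Szegedy, C. Umans, FOCS 2005 (arXiv:math/0511460), Def. 5.1.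
-/

namespace Summit.MatrixMultiplication.OmegaCensus

namespace T1CosetEng

/-- KERNEL: root `d = 59`, chunk 20 (codes `x = 30 … 33` of the branching label's lane; 91,033 search calls). -/
theorem hc09_d59_c20 : rootDX [0, 4, 5, 6, 12, 20, 31, 36, 47, 55] 59 16106127360 = true := by decide +kernel

/-- KERNEL: root `d = 59`, chunk 21 (codes `x = 34 … 35` of the branching label's lane; 93,979 search calls). -/
theorem hc09_d59_c21 : rootDX [0, 4, 5, 6, 12, 20, 31, 36, 47, 55] 59 51539607552 = true := by decide +kernel

/-- KERNEL: root `d = 59`, chunk 22 (codes `x = 36 … 38` of the branching label's lane; 60,388 search calls). -/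
theorem hc09_d59_c22 : rootDX [0, 4, 5, 6, 12, 20, 31, 36, 47, 55] 59 481036337152 = true := by decide +kernel

/-- KERNEL: root `d = 59`, chunk 23 (codes `x = 39 … 40` of the branching label's lane; 86,561 search calls). -/
theorem hc09_d59_c23 : rootDX [0, 4, 5, 6, 12, 20, 31, 36, 47, 55] 59 1649267441664 = true := by decide +kernel

/-- KERNEL: root `d = 59`, chunk 24 (codes `x = 41 … 45` of the branching label's lane; 92,609 search calls). -/
theorem hc09_d59_c24 : rootDX [0, 4, 5, 6, 12, 20, 31, 36, 47, 55] 59 68169720922112 = true := by decide +kernel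

/-- KERNEL: root `d = 59`, chunk 25 (codes `x = 46 … 63` of the branching label's lane; 65,549 search calls). -/
theorem hc09_d59_c25 : rootDX [0, 4, 5, 6, 12, 20, 31, 36, 47, 55] 59 18446673704965373952 = true := by decide +kernel

end T1CosetEng

end Summit.MatrixMultiplication.OmegaCensus
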